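import Literature.Geometry.Lorentzian.GeodesicContinuousDependence
import HarnessLib

/-!
# The maximal geodesic flow is continuous on its open domain (Lee 2018, Thm. 4.27 / Prop. 5.19)

For a `C¹` covariant derivative `cov` on the tangent bundle of a Hausdorff manifold `M` without
boundary (finite-dimensional complete model), in the framework of
`Literature.Geometry.Lorentzian.Geodesic` and of the maximal geodesics
`γ_v = Literature.Geometry.Riemannian.maximalGeodesic cov x v` with domain
`maximalGeodesicDomain cov x v` (`Literature/Geometry/Riemannian/ExponentialMap.lean`; Lee 2018,
Cor. 4.28), this file proves — WITHOUT any completeness assumption, complementing the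
complete-connection results of `Literature.Geometry.Lorentzian.GeodesicContinuousDependence`:

* `tangentLift_maximalGeodesic_zero_of_hasMaximalGeodesic` — `(γ_p 0, γ_p' 0) = p`;
* `maximalGeodesicDomain_tangentLift_eq`, `maximalGeodesic_tangentLift_eqOn` — the **flow
  property** of maximal geodesics: the maximal geodesic issuing from `(γ_p s, γ_p' s)`,
  `s ∈ dom γ_p`, has domain `dom γ_p - s` and is the translate `u ↦ γ_p (u + s)` (O'Neill 1983,
  Ch. 3, Prop. 24 and Def. 27 ff.; translates of maximal geodesics are maximal);
* `Ioo_subset_maximalGeodesicDomain_of_isGeodesicOn` — a geodesic on `(-ε, ε)` with tangent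
  lift `p` at `0` lives inside `dom γ_p` and agrees with `γ_p` there (O'Neill, Prop. 24:
  "if `α : J → M` is a geodesic with initial velocity `v`, then `J ⊂ I_v` and `α = γ_v | J`");
* `isOpen_continuousOn_of_flow` — a topological-space version of
  `Literature.Geometry.Manifold.isOpen_contMDiffOn_of_flow`: group law + local joint continuity
  near `t = 0` imply that the flow domain is open and the flow is continuous on it
  (Bröcker–Jänich 1982, proof of (8.11); Lee 2012, Thm. 9.12 (c)–(d));
* `isOpen_continuousOn_tangentLift_maximalGeodesic` — **the geodesic flow
  `(p, t) ↦ (γ_p t, γ_p' t)` has open domain `{(p, t) | t ∈ dom γ_p} ⊆ TM × ℝ` and is continuous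
  on it** (Lee 2018, Thm. 4.27 (c)–(d) and Prop. 5.19 for the continuity part; O'Neill 1983,
  Ch. 3, Lemma 22 and p. 70), with the base-point corollary
  `isOpen_continuousOn_maximalGeodesic`.

Everything is proved; no definitions, no named facts. Consumer: compactness of the set swept
out by the null normal geodesics of a compact surface up to a bounded affine parameter
(Hawking–Ellis 1973, §8.2, proof of Thm. 1: "the continuous map `β : 𝒯 × [0, b] × Q → ℳ`").

## References

* J. M. Lee, *Introduction to Riemannian Manifolds*, 2nd ed., GTM 176 (2018), Thm. 4.27,
  Cor. 4.28, Prop. 5.19. [LeeRiemannianManifolds2018]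
* B. O'Neill, *Semi-Riemannian geometry with applications to relativity*, Academic Press 1983,
  Ch. 3, Lemma 22, Prop. 24, Def. 27 ff. (pp. 68–70). [ONeill1983]
* J. M. Lee, *Introduction to Smooth Manifolds*, 2nd ed., GTM 218 (2012), Thm. 9.12.
  [LeeSmoothManifolds2013]
-/

noncomputable section

open Bundle Set Filter Metric Function
open scoped Manifold ContDiff Topology

namespace Literature.Geometry.Lorentzian

/-! ### Flows on topological spaces: open domain and continuity from the group law -/

/-- **Open domain and continuity of a flow from the group law and local continuity**
(topological-space version of `Literature.Geometry.Manifold.isOpen_contMDiffOn_of_flow`;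
Bröcker–Jänich 1982, proof of (8.11); Lee 2012, Thm. 9.12 (c)–(d)). Let `Θ x` be a curve on the
open interval `D x ∋ 0`, continuous at every parameter of `D x`, with the group law
`D (Θ x s) = {t | t + s ∈ D x}`, `Θ (Θ x s) t = Θ x (t + s)` (`s ∈ D x`), and assume that every
point has a neighbourhood `U` and `ε > 0` with `(-ε, ε) ⊆ D x` on `U` and `(x, t) ↦ Θ x t`
continuous on `U × (-ε, ε)`. Then `{(x, t) | t ∈ D x}` is open and `(x, t) ↦ Θ x t` is
continuous on it. [cite: LeeSmoothManifolds2013, Thm. 9.12 (c)–(d)] -/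
theorem isOpen_continuousOn_of_flow {X : Type*} [TopologicalSpace X] {Θ : X → ℝ → X}
    {D : X → Set ℝ}
    (hD : ∀ x, IsOpen (D x) ∧ (D x).OrdConnected ∧ 0 ∈ D x ∧ ∀ t ∈ D x, ContinuousAt (Θ x) t)
    (hgrp : ∀ x, ∀ s ∈ D x, D (Θ x s) = {t | t + s ∈ D x} ∧
      ∀ t, t + s ∈ D x → Θ (Θ x s) t = Θ x (t + s))
    (hloc : ∀ x₀, ∃ U : Set X, IsOpen U ∧ x₀ ∈ U ∧ ∃ ε > (0 : ℝ), (∀ x ∈ U, Ioo (-ε) ε ⊆ D x) ∧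
      ContinuousOn (fun p : X × ℝ => Θ p.1 p.2) (U ×ˢ Ioo (-ε) ε)) :
    IsOpen {p : X × ℝ | p.2 ∈ D p.1} ∧
      ContinuousOn (fun p : X × ℝ => Θ p.1 p.2) {p : X × ℝ | p.2 ∈ D p.1} := by
  set F : X × ℝ → X := fun p => Θ p.1 p.2 with hF
  set 𝒟 : Set (X × ℝ) := {p : X × ℝ | p.2 ∈ D p.1} with h𝒟
  suffices key : ∀ (x₁ : X), ∀ t ∈ D x₁, ∃ W : Set (X × ℝ), IsOpen W ∧ (x₁, t) ∈ W ∧ W ⊆ 𝒟 ∧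
      ContinuousOn F W by
    refine ⟨isOpen_iff_forall_mem_open.2 ?_, ?_⟩
    · rintro ⟨x₁, t⟩ ht
      obtain ⟨W, hWo, hW, hW𝒟, -⟩ := key x₁ t ht
      exact ⟨W, hW𝒟, hWo, hW⟩
    · rintro ⟨x₁, t⟩ ht
      obtain ⟨W, hWo, hW, -, hFW⟩ := key x₁ t ht
      exact ((hFW _ hW).continuousAt (hWo.mem_nhds hW)).continuousWithinAt
  intro x₁
  set S : Set ℝ := {t | ∃ W : Set (X × ℝ), IsOpen W ∧ (x₁, t) ∈ W ∧ W ⊆ 𝒟 ∧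
      ContinuousOn F W} with hS
  suffices hsub : D x₁ ⊆ S from fun t ht => hsub ht
  -- `S` is open
  have hSo : IsOpen S := by
    rw [isOpen_iff_mem_nhds]
    rintro t ⟨W, hWo, htW, hW𝒟, hFW⟩
    have hmem : {s : ℝ | (x₁, s) ∈ W} ∈ 𝓝 t :=
      (hWo.preimage (continuous_const.prodMk continuous_id)).mem_nhds htW
    filter_upwards [hmem] with s hs
    exact ⟨W, hWo, hs, hW𝒟, hFW⟩
  -- `0 ∈ S`
  have hS0 : (0 : ℝ) ∈ S := by
    obtain ⟨U, hUo, hx₁U, ε, hε, hUD, hsm⟩ := hloc x₁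
    refine ⟨U ×ˢ Ioo (-ε) ε, hUo.prod isOpen_Ioo, ⟨hx₁U, ⟨by linarith, hε⟩⟩, ?_, hsm⟩
    rintro ⟨x, t⟩ ⟨hx, ht⟩
    exact hUD x hx ht
  -- `S` is closed in `D x₁`
  have hSc : closure S ∩ D x₁ ⊆ S := by
    rintro tstar ⟨htstar, htD⟩
    obtain ⟨U, hUo, hpU, ε, hε, hUD, hsm⟩ := hloc (Θ x₁ tstar)
    have hcont : ContinuousAt (Θ x₁) tstar := (hD x₁).2.2.2 tstar htD
    obtain ⟨δ, hδ, hδU⟩ : ∃ δ > (0 : ℝ), ∀ s, dist s tstar < δ → Θ x₁ s ∈ U := by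
      have hpre : (Θ x₁) ⁻¹' U ∈ 𝓝 tstar := hcont.preimage_mem_nhds (hUo.mem_nhds hpU)
      obtain ⟨δ, hδ, hball⟩ := Metric.mem_nhds_iff.1 hpre
      exact ⟨δ, hδ, fun s hs => hball hs⟩
    obtain ⟨t₁, ht₁S, ht₁⟩ :=
      Metric.mem_closure_iff.1 htstar (min δ (ε / 2)) (lt_min hδ (half_pos hε))
    obtain ⟨W₁, hW₁o, hW₁, hW₁𝒟, hFW₁⟩ := ht₁S
    have hd1 : dist t₁ tstar < δ := by
      rw [dist_comm]; exact lt_of_lt_of_le ht₁ (min_le_left _ _)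
    have hd2 : |tstar - t₁| < ε / 2 := by
      rw [← Real.dist_eq]; exact lt_of_lt_of_le ht₁ (min_le_right _ _)
    set V₁ : Set X := {x | (x, t₁) ∈ W₁} with hV₁
    have hV₁o : IsOpen V₁ := hW₁o.preimage (continuous_id.prodMk continuous_const)
    have hx₁V₁ : x₁ ∈ V₁ := hW₁
    have hV₁D : ∀ x ∈ V₁, t₁ ∈ D x := fun x hx => hW₁𝒟 hx
    have hG : ContinuousOn (fun x => Θ x t₁) V₁ :=
      hFW₁.comp (continuousOn_id.prodMk continuousOn_const) fun x hx => hx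
    set W : Set (X × ℝ) := (V₁ ∩ (fun x => Θ x t₁) ⁻¹' U) ×ˢ Ioo (t₁ - ε) (t₁ + ε) with hW
    have hWo : IsOpen W := (hG.isOpen_inter_preimage hV₁o hUo).prod isOpen_Ioo
    have hmemW : (x₁, tstar) ∈ W := by
      refine ⟨⟨hx₁V₁, ?_⟩, ?_⟩
      · exact hδU t₁ hd1
      · rw [abs_lt] at hd2
        constructor <;> linarith
    have hW𝒟 : W ⊆ 𝒟 := by
      rintro ⟨x, t⟩ ⟨⟨hxV₁, hxU⟩, ht1, ht2⟩
      have ht₁D : t₁ ∈ D x := hV₁D x hxV₁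
      have hsub : Ioo (-ε) ε ⊆ D (Θ x t₁) := hUD _ hxU
      have hmem : t - t₁ ∈ D (Θ x t₁) := hsub ⟨by linarith, by linarith⟩
      rw [(hgrp x t₁ ht₁D).1] at hmem
      show t ∈ D x
      simpa using hmem
    refine ⟨W, hWo, hmemW, hW𝒟, ?_⟩
    have hinner : ContinuousOn (fun q : X × ℝ => (Θ q.1 t₁, q.2 - t₁)) W := by
      refine ContinuousOn.prodMk ?_ ?_
      · exact hG.comp continuousOn_fst fun q hq => hq.1.1
      · exact (continuous_id.sub continuous_const).comp_continuousOn continuousOn_snd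
    have hcomp := hsm.comp hinner fun q hq => by
      obtain ⟨⟨-, hq1⟩, hq2, hq3⟩ := hq
      exact ⟨hq1, ⟨by linarith, by linarith⟩⟩
    refine hcomp.congr fun q hq => ?_
    have ht₁D : t₁ ∈ D q.1 := hV₁D q.1 hq.1.1
    have hq𝒟 : q.2 ∈ D q.1 := hW𝒟 hq
    show Θ q.1 q.2 = Θ (Θ q.1 t₁) (q.2 - t₁)
    rw [(hgrp q.1 t₁ ht₁D).2 (q.2 - t₁) (by simpa using hq𝒟), sub_add_cancel]
  exact ((hD x₁).2.1.isPreconnected).subset_of_closure_inter_subset hSo ⟨0, (hD x₁).2.2.1, hS0⟩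
    hSc

/-! ### The maximal geodesic flow -/

section MaximalGeodesic

open Literature.Geometry.Riemannian

universe u

variable {E : Type u} [NormedAddCommGroup E] [NormedSpace ℝ E] {H : Type*} [TopologicalSpace H]
  {I : ModelWithCorners ℝ E H} {M : Type*} [TopologicalSpace M] [ChartedSpace H M]
  [IsManifold I ∞ M] [FiniteDimensional ℝ E]
  {cov : CovariantDerivative I E (TangentSpace I : M → Type _)}
  [CompleteSpace E] [T2Space M] [BoundarylessManifold I M]
  [CovariantDerivative.ContMDiffCovariantDerivative cov 1]

/-- The tangent lift of the maximal geodesic `γ_p` at `0` is `p` (any `C¹` connection on a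
Hausdorff manifold without boundary; cf. `tangentLift_maximalGeodesic_zero` for complete ones).
Lee 2018, Cor. 4.28 and p. 126. [cite: LeeRiemannianManifolds2018, Cor. 4.28 and p. 126] -/
theorem tangentLift_maximalGeodesic_zero_of_hasMaximalGeodesic (p : TangentBundle I M) :
    tangentLift I (maximalGeodesic cov p.proj p.snd) 0 = p := by
  obtain ⟨-, -, hx, hv⟩ := maximalGeodesic_spec (hasMaximalGeodesic (cov := cov) p.proj p.snd)
  exact TotalSpace.ext hx (heq_of_eq hv)

omit [CompleteSpace E] [T2Space M] [BoundarylessManifold I M]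
  [CovariantDerivative.ContMDiffCovariantDerivative cov 1] in
/-- **Translates of maximal geodesics are maximal** (O'Neill 1983, Ch. 3, Prop. 24 with
Def. 20): if `γ` is a maximal geodesic on `s`, then for every `s₀` the translate
`u ↦ γ (u - (-s₀)) = γ (u + s₀)` is a maximal geodesic on `{u | u + s₀ ∈ s}` (an extension of the
translate would translate back to an extension of `γ`). [cite: ONeill1983, Ch. 3, Prop. 24] -/
theorem IsMaximalGeodesicOn.comp_add {γ : ℝ → M} {s : Set ℝ} (hγ : IsMaximalGeodesicOn cov γ s)
    (s₀ : ℝ) :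
    IsMaximalGeodesicOn cov (fun u ↦ γ (u - (-s₀))) {u | u + s₀ ∈ s} := by
  obtain ⟨hso, hsc, hg, hmax⟩ := hγ
  have hJ : {u : ℝ | u + s₀ ∈ s} = (fun u ↦ u - (-s₀)) ⁻¹' s := by
    ext u; simp [sub_neg_eq_add]
  refine ⟨hso.preimage (continuous_add_const s₀), ?_, ?_, ?_⟩
  · exact ⟨fun a ha b hb u hu ↦ hsc.out ha hb ⟨by linarith [hu.1], by linarith [hu.2]⟩⟩
  · rw [hJ]; exact hg.comp_sub_const (-s₀)
  · intro γ'' s'' hs''o hs''c hsub hg'' heq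
    -- translate `γ''` back: an extension of `γ`
    have hg''' : IsGeodesicOn cov (fun u ↦ γ'' (u - s₀)) ((fun u ↦ u - s₀) ⁻¹' s'') :=
      hg''.comp_sub_const s₀
    have hsub' : s ⊆ (fun u ↦ u - s₀) ⁻¹' s'' := fun u hu ↦ hsub (by
      show u - s₀ + s₀ ∈ s
      rw [sub_add_cancel]; exact hu)
    have heq' : EqOn γ (fun u ↦ γ'' (u - s₀)) s := by
      intro u hu
      have h1 : u - s₀ ∈ {u : ℝ | u + s₀ ∈ s} := by
        show u - s₀ + s₀ ∈ s
        rw [sub_add_cancel]; exact hu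
      have h2 := heq h1
      simp only [sub_neg_eq_add, sub_add_cancel] at h2
      exact h2
    have hs'''c : ((fun u ↦ u - s₀) ⁻¹' s'').OrdConnected :=
      ⟨fun a ha b hb u hu ↦ hs''c.out ha hb ⟨by linarith [hu.1], by linarith [hu.2]⟩⟩
    have hs'''o : IsOpen ((fun u ↦ u - s₀) ⁻¹' s'') :=
      hs''o.preimage (by fun_prop)
    have h := hmax _ _ hs'''o hs'''c hsub' hg''' heq'
    ext u
    constructor
    · intro hu
      have : u + s₀ ∈ (fun u ↦ u - s₀) ⁻¹' s'' := by
        show u + s₀ - s₀ ∈ s''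
        rw [add_sub_cancel_right]; exact hu
      rw [h] at this
      exact this
    · intro hu; exact hsub hu

/-- **Flow property of maximal geodesics, domains**: for `s ∈ dom γ_p` the maximal geodesic
issuing from the tangent lift `(γ_p s, γ_p' s)` has domain `{t | t + s ∈ dom γ_p}` and is the
translate `t ↦ γ_p (t + s)` there (O'Neill 1983, Ch. 3, Prop. 24 and Def. 27 ff.; Lee 2018,
proof of Thm. 4.27 / Lemma 5.18 (rescaling lemma's translation analogue)).
[cite: ONeill1983, Ch. 3, Prop. 24 and Def. 27 ff.] -/
theorem maximalGeodesicDomain_tangentLift_eq (p : TangentBundle I M) {s : ℝ}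
    (hs : s ∈ maximalGeodesicDomain cov p.proj p.snd) :
    maximalGeodesicDomain cov (tangentLift I (maximalGeodesic cov p.proj p.snd) s).proj
        (tangentLift I (maximalGeodesic cov p.proj p.snd) s).snd =
      {t | t + s ∈ maximalGeodesicDomain cov p.proj p.snd} ∧
    EqOn (fun t ↦ maximalGeodesic cov p.proj p.snd (t + s))
      (maximalGeodesic cov (tangentLift I (maximalGeodesic cov p.proj p.snd) s).proj
        (tangentLift I (maximalGeodesic cov p.proj p.snd) s).snd)
      {t | t + s ∈ maximalGeodesicDomain cov p.proj p.snd} := by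
  obtain ⟨hmax, -, -, -⟩ := maximalGeodesic_spec (hasMaximalGeodesic (cov := cov) p.proj p.snd)
  have htr := hmax.comp_add s
  have h0 : (0 : ℝ) ∈ {t : ℝ | t + s ∈ maximalGeodesicDomain cov p.proj p.snd} := by
    show (0 : ℝ) + s ∈ maximalGeodesicDomain cov p.proj p.snd
    rw [zero_add]; exact hs
  have hx : (fun u ↦ maximalGeodesic cov p.proj p.snd (u - (-s))) 0 =
      (tangentLift I (maximalGeodesic cov p.proj p.snd) s).proj := by
    simp
  have hv : velocity I (fun u ↦ maximalGeodesic cov p.proj p.snd (u - (-s))) 0 =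
      (tangentLift I (maximalGeodesic cov p.proj p.snd) s).snd := by
    rw [velocity_comp_sub_const, tangentLift_snd, zero_sub, neg_neg]
  obtain ⟨hdom, heq⟩ := maximalGeodesic_unique htr h0 hx hv
  refine ⟨hdom.symm, fun t ht ↦ ?_⟩
  have := heq ht
  simp only [sub_neg_eq_add] at this
  exact this

/-- **A geodesic on an open interval about `0` lies inside the maximal geodesic with the same
tangent lift at `0`** (O'Neill 1983, Ch. 3, Prop. 24: "`J ⊂ I_v` and `α = γ_v | J`"): if `Γ` is a
geodesic on `(-ε, ε)` with `tangentLift Γ 0 = p`, then `(-ε, ε) ⊆ dom γ_p` and `Γ = γ_p` on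
`(-ε, ε)`. Proof: glue `γ_p` and `Γ` (`IsGeodesicOn.piecewise`) to a geodesic on
`dom γ_p ∪ (-ε, ε)` extending `γ_p`; maximality. [cite: ONeill1983, Ch. 3, Prop. 24] -/
theorem Ioo_subset_maximalGeodesicDomain_of_isGeodesicOn {Γ : ℝ → M} {ε : ℝ} (hε : 0 < ε)
    (hΓ : IsGeodesicOn cov Γ (Ioo (-ε) ε)) {p : TangentBundle I M} (h0 : tangentLift I Γ 0 = p) :
    Ioo (-ε) ε ⊆ maximalGeodesicDomain cov p.proj p.snd ∧
      EqOn Γ (maximalGeodesic cov p.proj p.snd) (Ioo (-ε) ε) := by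
  classical
  obtain ⟨hmax, h0D, hx, hv⟩ := maximalGeodesic_spec (hasMaximalGeodesic (cov := cov) p.proj p.snd)
  set γ := maximalGeodesic cov p.proj p.snd with hγdef
  set D := maximalGeodesicDomain cov p.proj p.snd with hDdef
  obtain ⟨hDo, hDc, hg, hm⟩ := hmax
  have h00 : (0 : ℝ) ∈ Ioo (-ε) ε := ⟨by linarith, hε⟩
  have hlift : tangentLift I γ 0 = tangentLift I Γ 0 := by
    rw [h0]; exact TotalSpace.ext hx (heq_of_eq hv)
  obtain ⟨hG, hGγ, hGΓ⟩ := hg.piecewise hDo isOpen_Ioo (hDc.inter ordConnected_Ioo) hΓ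
    ⟨h0D, h00⟩ hlift
  -- the union is an open interval extending `D`, hence equal to `D`
  have hUc : (D ∪ Ioo (-ε) ε).OrdConnected := by
    rw [← isPreconnected_iff_ordConnected]
    exact IsPreconnected.union 0 h0D h00 hDc.isPreconnected ordConnected_Ioo.isPreconnected
  have hU : D ∪ Ioo (-ε) ε = D :=
    hm _ _ (hDo.union isOpen_Ioo) hUc subset_union_left hG hGγ.symm
  have hsub : Ioo (-ε) ε ⊆ D := by rw [← hU]; exact subset_union_right
  refine ⟨hsub, ?_⟩
  exact IsGeodesicOn.eqOn_of_velocity_eq_holds isOpen_Ioo ordConnected_Ioo hΓ (hg.mono hsub) h00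
    (hx.symm ▸ (congrArg TotalSpace.proj h0)) (by
      have := (TotalSpace.mk.inj h0).2
      exact (eq_of_heq this).trans hv.symm)

/-- **The maximal geodesic flow is continuous on its open domain** (Lee 2018, Thm. 4.27 (c)–(d)
and Prop. 5.19, continuity part; O'Neill 1983, Ch. 3, Lemma 22 and p. 70). For a `C¹` connection
on a Hausdorff manifold without boundary, the set `{(p, t) ∈ TM × ℝ | t ∈ dom γ_p}` is open and
the geodesic flow `(p, t) ↦ (γ_p t, γ_p' t) ∈ TM` is continuous on it: local continuity near
`t = 0` (`exists_nhds_continuousOn_isGeodesicOn`, the local families agreeing with the maximal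
geodesics by `Ioo_subset_maximalGeodesicDomain_of_isGeodesicOn`) is spread along orbits by the
flow property (`maximalGeodesicDomain_tangentLift_eq`) and `isOpen_continuousOn_of_flow`.
[cite: LeeRiemannianManifolds2018, Thm. 4.27 (c)–(d) and Prop. 5.19] -/
theorem isOpen_continuousOn_tangentLift_maximalGeodesic :
    IsOpen {q : TangentBundle I M × ℝ | q.2 ∈ maximalGeodesicDomain cov q.1.proj q.1.snd} ∧
      ContinuousOn (fun q : TangentBundle I M × ℝ ↦
          tangentLift I (maximalGeodesic cov q.1.proj q.1.snd) q.2)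
        {q : TangentBundle I M × ℝ | q.2 ∈ maximalGeodesicDomain cov q.1.proj q.1.snd} := by
  set Θ : TangentBundle I M → ℝ → TangentBundle I M :=
    fun p t ↦ tangentLift I (maximalGeodesic cov p.proj p.snd) t with hΘ
  set D : TangentBundle I M → Set ℝ := fun p ↦ maximalGeodesicDomain cov p.proj p.snd with hD
  have hspec := fun p : TangentBundle I M ↦
    maximalGeodesic_spec (hasMaximalGeodesic (cov := cov) p.proj p.snd)
  refine isOpen_continuousOn_of_flow (Θ := Θ) (D := D) (fun p ↦ ?_) (fun p s hs ↦ ?_) (fun p₀ ↦ ?_)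
  · obtain ⟨⟨hDo, hDc, hg, -⟩, h0, -, -⟩ := hspec p
    exact ⟨hDo, hDc, h0, fun t ht ↦ (hg.1 t ht).continuousAt⟩
  · obtain ⟨hdom, heq⟩ := maximalGeodesicDomain_tangentLift_eq (cov := cov) p hs
    refine ⟨hdom, fun t ht ↦ ?_⟩
    -- `Θ (Θ p s) t = tangentLift γ_p (t + s)` by locality of the tangent lift
    have hJo : IsOpen {t : ℝ | t + s ∈ D p} := (hspec p).1.1.preimage (continuous_add_const s)
    have hev : maximalGeodesic cov (Θ p s).proj (Θ p s).snd =ᶠ[𝓝 t]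
        fun u ↦ maximalGeodesic cov p.proj p.snd (u - (-s)) := by
      filter_upwards [hJo.mem_nhds ht] with u hu
      rw [sub_neg_eq_add]
      exact (heq hu).symm
    show tangentLift I (maximalGeodesic cov (Θ p s).proj (Θ p s).snd) t =
      tangentLift I (maximalGeodesic cov p.proj p.snd) (t + s)
    rw [tangentLift_congr_of_eventuallyEq hev, tangentLift_comp_sub_const, sub_neg_eq_add]
  · obtain ⟨𝒰, h𝒰, ε, hε, Γ, hΓ, hcont⟩ :=
      exists_nhds_continuousOn_isGeodesicOn (cov := cov) p₀ BoundarylessManifold.isInteriorPoint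
    have hagree : ∀ p ∈ 𝒰, Ioo (-ε) ε ⊆ D p ∧
        EqOn (Γ p) (maximalGeodesic cov p.proj p.snd) (Ioo (-ε) ε) := fun p hp ↦
      Ioo_subset_maximalGeodesicDomain_of_isGeodesicOn hε (hΓ p hp).1 (hΓ p hp).2
    refine ⟨interior 𝒰, isOpen_interior, mem_interior_iff_mem_nhds.2 h𝒰, ε, hε,
      fun p hp ↦ (hagree p (interior_subset hp)).1, ?_⟩
    refine (hcont.mono (prod_mono interior_subset Subset.rfl)).congr fun q hq ↦ ?_
    have hp : q.1 ∈ 𝒰 := interior_subset hq.1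
    have hev : maximalGeodesic cov q.1.proj q.1.snd =ᶠ[𝓝 q.2] Γ q.1 := by
      filter_upwards [isOpen_Ioo.mem_nhds hq.2] with u hu
      exact ((hagree q.1 hp).2 hu).symm
    exact tangentLift_congr_of_eventuallyEq hev

/-- **The base points of the maximal geodesics depend continuously on `(p, t)`** on the open
flow domain: `(p, t) ↦ γ_p t` is continuous on `{(p, t) | t ∈ dom γ_p}` (projection of
`isOpen_continuousOn_tangentLift_maximalGeodesic`). Lee 2018, Thm. 4.27 (d); O'Neill 1983,
Ch. 3, p. 70. [cite: LeeRiemannianManifolds2018, Thm. 4.27 (d)] -/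
theorem isOpen_continuousOn_maximalGeodesic :
    IsOpen {q : TangentBundle I M × ℝ | q.2 ∈ maximalGeodesicDomain cov q.1.proj q.1.snd} ∧
      ContinuousOn (fun q : TangentBundle I M × ℝ ↦ maximalGeodesic cov q.1.proj q.1.snd q.2)
        {q : TangentBundle I M × ℝ | q.2 ∈ maximalGeodesicDomain cov q.1.proj q.1.snd} := by
  obtain ⟨hopen, hcont⟩ := isOpen_continuousOn_tangentLift_maximalGeodesic (cov := cov)
  refine ⟨hopen, ?_⟩
  have h := (FiberBundle.continuous_proj E (TangentSpace I : M → Type _)).comp_continuousOn hcont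
  exact h.congr fun q _ ↦ rfl

end MaximalGeodesic

end Literature.Geometry.Lorentzian

end
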